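import Summits.QuantumFields.BalabanUV.Beta.EriceRemainderEnclosureHistoryAutonomyComparisonAgeCompositionOldBlockLetters
import Summits.QuantumFields.BalabanUV.Beta.EriceRemainderEnclosureHistoryAutonomyComparisonAgeCompositionOldPairLettersSplit
import Summits.QuantumFields.BalabanUV.Beta.EriceRemainderEnclosureHistoryAutonomyComparisonAffineProfile

/-!
# EriceRemainderEnclosureHistoryAutonomyComparisonAgeCompositionOldTripleLetters — (E103a) route (N), first order: THE OLD-TRIPLE POLYTOPE.  Three OLD
# ages `j < k < n` at a pin `m`, loads `x = x_j(m)`, `z = x_k(m)`, `y = x_n(m)`, level ratios `σ₁ = h_{m+j}∕h_{m+k}`, `σ₂ = h_{m+k}∕h_{m+n}`.  The three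
# PIN WINDOWS `[m, m+j)`, `[m, m+k)`, `[m, m+n)` give three letters (every coefficient a displayed function of `σ₁, σ₂, k∕j, n∕k` and tangent constants;
# younger ages by the SPLIT stretch of (E102b), older ages by the ray through their own level, own ages by (E94b)):
#   (W_j)  `2c₀·x + 2c₁(j∕k)σ₁²·z + 2c₂(j∕n)(σ₁σ₂)²·y ≤ 1`,
#   (W_k)  `[2c_{T₁}(T₁∕j)∕σ₁² + 2((k−j−T₁)∕j + c₁)∕σ₁³]·x + 2c₀·z + 2c₃(k∕n)σ₂²·y ≤ 1`,
#   (W_n)  `[2c_{T₂}(T₂∕j)∕(σ₁σ₂)² + 2((n−j−T₂)∕j + c₂)∕(σ₁σ₂)³]·x + [2c_{T₃}(T₃∕k)∕σ₂² + 2((n−k−T₃)∕k + c₃)∕σ₂³]·z + 2c₀·y ≤ 1`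
# (**`triple_letter_young ∕ _mid ∕ _old`**), and the geometry: `1 ≤ σ₁`, `1 ≤ σ₂`, `σ₁²j ≤ k`, `σ₂²k ≤ n` (rays from the pin) and the CHORD
# CONCAVITY `(k−j)·σ₁²(σ₂²−1) ≤ (n−k)·(σ₁²−1)` — every level increment after `m+k` is at most every one before ((E75) `increment_anti`) —
# (**`chord_concavity`**, **`triple_sigma_bounds`**).  Numerics (`HOME/b2b-balaban-beta-d4-p2/g89/numerics/`, README §3): the LP over this polytope
# (maximised over the admissible `σ₁, σ₂`) equals the PAIR value of `{j, n}` at every pair of spans tried — the interior age is never loaded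
# (`0.616 ∕ 0.626 ∕ 0.654 ∕ 0.69` at total spans `3 ∕ 4 ∕ 8 ∕ 16` with these tangent letters); the certificate is a 4-dimensional box table with three
# multipliers per box (`cert_triple.py`: 52–300 boxes per cell of `(k∕j, n∕k)` brackets at `V ≈` LP value `+ 0.02`), typed by the sequels.

Cell `pub-balaban`, β-function sub-cell, BINDER row D4 «RemainderConst leaves for Bałaban's split» (`HOME/BINDER-OWNERS.md`; owner lineage `b2b-balaban-beta-an4`;
this file by co-owner #2 lineage `b2b-balaban-beta-d4-p2`, generation 89), β-FLOW TEAM duty (1), FREEZE (0) honoured (def-free; nothing restated).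

HONEST FRAMING (page 1, verbatim and binding).  *"Discharging BetaPertH makes Bałaban's UV stability UNCONDITIONAL — a real constructive-QFT result; it is
NOT the continuum limit and NOT the Clay problem."*  THIS FILE DISCHARGES NOTHING OF THE KIND.  Elementary real algebra ∕ real analysis about ABSTRACT
functionals on a box ]0,γ]^ℕ with displayed floors, profiles and signs, and the FIRST-ORDER renewal objects of route (N) built from them — hypotheses of a
census, not facts; the form, signs, ages and moments of Bałaban's (1.22) limit functional are NOT PRINTED ([I] p. 298; GAPS G-t4-U2-1∕-2) and NOT asserted.
Row D4 class UNCHANGED (critical-path width 0; instance 0∕1; D4 DISCHARGE NO DATE).  HONEST DEPENDENCY: continuum YM on T⁴ ⇐ BetaPertH ∧ nine spine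
estimates (0/9 proved); BetaPertH ⇐ (D1) ∧ (D4) ∧ CAP+tail; G-an2-4 gates asym, D1 and NE2/3/4.

THE POINT (README `HOME/b2b-balaban-beta-d4-p2/g89/README.md` §3).  Uses (E100a) `block_window_reads_le`, `old_reads_ge`, (E94b) `window_sum_ge`, (E99a) `ray_sum_ge`,
(E102b) `own_const_mono`, `old_pair_letters_split` (for the pin rays), (E75) `increment_anti`, (E79) `strictAnti_of_memFlow` BY NAME.  NOT CLAIMED: a cap
(sequels); anything printed — NOT B12 Thm 2, NOT BetaPertH, NOT continuum, NOT Clay.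

WHAT IS PROVED ([folklore]; 0 `def`, 0 sorry).  §1 `young_reads_ge_split`, **`chord_concavity`**, **`triple_sigma_bounds`**.  §2 **`triple_letter_young`**,
**`triple_letter_mid`**, **`triple_letter_old`**.
-/
noncomputable section
open Finset

namespace Summit.QuantumFields.BalabanUV.Beta.EriceRemainderEnclosureHistoryAutonomyComparisonAgeCompositionOldTripleLetters

open Literature.MathematicalPhysics.QuantumFieldTheory.Balaban1983to89
open Literature.MathematicalPhysics.QuantumFieldTheory.Balaban1983to89.T4BetaStationary
open Literature.MathematicalPhysics.QuantumFieldTheory.Balaban1983to89.T4BetaFlowWellPosed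
open Summit.QuantumFields.BalabanUV.Beta.EriceRemainderEnclosureHistoryAutonomyOrder (strictAnti_of_memFlow)
open Summit.QuantumFields.BalabanUV.Beta.EriceRemainderEnclosureHistoryAutonomyComparisonAffineProfile (increment_anti)
open Summit.QuantumFields.BalabanUV.Beta.EriceRemainderEnclosureHistoryAutonomyComparisonAgeCompositionYoungPairMoment (window_sum_ge)
open Summit.QuantumFields.BalabanUV.Beta.EriceRemainderEnclosureHistoryAutonomyComparisonAgeCompositionOldPairLetters (ray_sum_ge)
open Summit.QuantumFields.BalabanUV.Beta.EriceRemainderEnclosureHistoryAutonomyComparisonAgeCompositionOldPairLettersSplit (own_const_mono old_pair_letters_split)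
open Summit.QuantumFields.BalabanUV.Beta.EriceRemainderEnclosureHistoryAutonomyComparisonAgeCompositionOldBlockLetters (block_window_reads_le old_reads_ge)

variable {B : (ℕ → ℝ) → ℝ} {γ b gIR : ℝ} {L : ℕ → ℝ} {K : ℕ} {h : ℕ → ℝ}

/-! ## §1 Reads of a younger age with the split stretch; the chord concavity of three levels -/

/-- **A YOUNGER AGE'S READS IN AN OLDER WINDOW, SPLIT STRETCH.**  Ages `1 ≤ i < n`, a split length `T` with `T + i ≤ n`, constants `c_T²(2i+T+1) ≤ 2i`
(the first `T` levels of the stretch `(m+i, m+n]` under the ray through `m+i`) and `c_b²(2n+i+1) ≤ 2n` (the far window `(m+n, m+n+i]` under the ray through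
`m+n`): `c_T·T·h_{m+i} + ((n−i−T) + c_b·i)·h_{m+n} ≤ Σ_{q<n} h_{m+q+1+i}` — the last `n−i−T` levels of the stretch are `≥ h_{m+n}` (the flow decreases).
[folklore] -/
theorem young_reads_ge_split (hmono : ∀ u v : ℕ → ℝ, SeqBox γ u → SeqBox γ v → (∀ j, u j ≤ v j) → B u ≤ B v) (hb : 0 < b)
    (hlo : ∀ u, SeqBox γ u → b ≤ B u) (hh : SeqBox γ h) (hf : MemFlow B gIR h) {i n T : ℕ} (hi : 1 ≤ i) (hin : i < n) (hT : T + i ≤ n)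
    {cT cb : ℝ} (hcT : cT ^ 2 * (2 * (i : ℝ) + T + 1) ≤ 2 * i) (hcb : cb ^ 2 * (2 * (n : ℝ) + i + 1) ≤ 2 * n) (m : ℕ) :
    cT * T * h (m + i) + (((n : ℝ) - i - T) + cb * i) * h (m + n) ≤ ∑ q ∈ range n, h (m + q + 1 + i) := by
  have hanti := (strictAnti_of_memFlow hb hlo hh hf).antitone
  obtain ⟨n₂, hn₂⟩ : ∃ n₂ : ℕ, n = T + n₂ + i := ⟨n - i - T, by omega⟩
  have hn₂r : (n₂ : ℝ) = (n : ℝ) - i - T := by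
    have : (n : ℝ) = (T : ℝ) + n₂ + i := by exact_mod_cast hn₂
    linarith
  have hRT : cT * T * h (m + i) ≤ ∑ q ∈ range T, h (m + i + 1 + q) := ray_sum_ge hmono hb hlo hh hf hi T hcT m
  have hFl : (n₂ : ℝ) * h (m + n) ≤ ∑ q ∈ range n₂, h (m + i + 1 + T + q) := by
    have : ∑ q ∈ range n₂, h (m + n) ≤ ∑ q ∈ range n₂, h (m + i + 1 + T + q) :=
      sum_le_sum fun q hq => hanti (by have := mem_range.mp hq; omega)
    rwa [sum_const, card_range, nsmul_eq_mul] at this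
  have hRb : cb * i * h (m + n) ≤ ∑ q ∈ range i, h (m + n + 1 + q) := ray_sum_ge hmono hb hlo hh hf (by omega) i hcb m
  have hsplit : ∑ q ∈ range n, h (m + q + 1 + i)
      = ∑ q ∈ range T, h (m + i + 1 + q) + ∑ q ∈ range n₂, h (m + i + 1 + T + q) + ∑ q ∈ range i, h (m + n + 1 + q) := by
    conv_lhs => rw [hn₂]
    rw [sum_range_add, sum_range_add]
    congr 1
    · congr 1
      · exact sum_congr rfl fun q _ => by rw [show m + q + 1 + i = m + i + 1 + q by ring]
      · exact sum_congr rfl fun q _ => by rw [show m + (T + q) + 1 + i = m + i + 1 + T + q by ring]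
    · exact sum_congr rfl fun q _ => by rw [show m + (T + n₂ + q) + 1 + i = m + n + 1 + q by omega]
  rw [hsplit, ← hn₂r]
  have : (((n₂ : ℝ)) + cb * i) * h (m + n) = (n₂ : ℝ) * h (m + n) + cb * i * h (m + n) := by ring
  linarith

/-- **THE CHORD CONCAVITY OF THREE LEVELS.**  `B` an isotone memory with floor `b > 0`, `h` a box solution, scales `j ≤ k ≤ n` past a pin `m`:
`(k−j)·(1∕h_{m+n}² − 1∕h_{m+k}²) ≤ (n−k)·(1∕h_{m+k}² − 1∕h_{m+j}²)` — each of the `n−k` increments after `m+k` is at most each of the `k−j` increments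
before ((E75) `increment_anti`); the slope of the profile `1∕h²` does not increase. [folklore] -/
theorem chord_concavity (hmono : ∀ u v : ℕ → ℝ, SeqBox γ u → SeqBox γ v → (∀ j, u j ≤ v j) → B u ≤ B v) (hb : 0 < b)
    (hlo : ∀ u, SeqBox γ u → b ≤ B u) (hh : SeqBox γ h) (hf : MemFlow B gIR h) {j k n : ℕ} (hjk : j ≤ k) (hkn : k ≤ n) (m : ℕ) :
    ((k : ℝ) - j) * (1 / h (m + n) ^ 2 - 1 / h (m + k) ^ 2) ≤ ((n : ℝ) - k) * (1 / h (m + k) ^ 2 - 1 / h (m + j) ^ 2) := by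
  -- the increments
  have hinc : ∀ p : ℕ, 1 / h (p + 1) ^ 2 - 1 / h p ^ 2 = B (fun i => h (p + 1 + i)) := fun p => by have := hf.2 p; linarith
  have htel : ∀ p d : ℕ, 1 / h (p + d) ^ 2 - 1 / h p ^ 2 = ∑ q ∈ range d, B (fun i => h (p + q + 1 + i)) := by
    intro p d
    induction d with
    | zero => simp
    | succ d ih =>
      rw [sum_range_succ, ← ih, show p + (d + 1) = p + d + 1 by ring, ← hinc (p + d)]
      ring
  have hlate : 1 / h (m + n) ^ 2 - 1 / h (m + k) ^ 2 ≤ ((n : ℝ) - k) * B (fun i => h (m + k + 1 + i)) := by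
    rw [show m + n = (m + k) + (n - k) by omega, htel]
    have : ∑ q ∈ range (n - k), B (fun i => h (m + k + q + 1 + i)) ≤ ∑ q ∈ range (n - k), B (fun i => h (m + k + 1 + i)) :=
      sum_le_sum fun q _ => by
        have := increment_anti hmono hb hlo hh hf (l := m + k) (l' := m + k + q) (by omega)
        simpa [Nat.add_assoc, Nat.add_comm, Nat.add_left_comm] using this
    rw [sum_const, card_range, nsmul_eq_mul, Nat.cast_sub hkn] at this
    exact this
  have hearly : ((k : ℝ) - j) * B (fun i => h (m + k + 1 + i)) ≤ 1 / h (m + k) ^ 2 - 1 / h (m + j) ^ 2 := by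
    rw [show m + k = (m + j) + (k - j) by omega, htel]
    have : ∑ q ∈ range (k - j), B (fun i => h (m + j + (k - j) + 1 + i)) ≤ ∑ q ∈ range (k - j), B (fun i => h (m + j + q + 1 + i)) :=
      sum_le_sum fun q hq => by
        have hq' := mem_range.mp hq
        have := increment_anti hmono hb hlo hh hf (l := m + j + q) (l' := m + j + (k - j)) (by omega)
        simpa [Nat.add_assoc, Nat.add_comm, Nat.add_left_comm] using this
    rw [sum_const, card_range, nsmul_eq_mul, Nat.cast_sub hjk] at this
    rw [show m + j + (k - j) = m + k by omega] at this ⊢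
    exact this
  have hkj : 0 ≤ (k : ℝ) - j := sub_nonneg.mpr (by exact_mod_cast hjk)
  have hnk : 0 ≤ (n : ℝ) - k := sub_nonneg.mpr (by exact_mod_cast hkn)
  calc ((k : ℝ) - j) * (1 / h (m + n) ^ 2 - 1 / h (m + k) ^ 2)
      ≤ ((k : ℝ) - j) * (((n : ℝ) - k) * B (fun i => h (m + k + 1 + i))) := mul_le_mul_of_nonneg_left hlate hkj
    _ = ((n : ℝ) - k) * (((k : ℝ) - j) * B (fun i => h (m + k + 1 + i))) := by ring
    _ ≤ ((n : ℝ) - k) * (1 / h (m + k) ^ 2 - 1 / h (m + j) ^ 2) := mul_le_mul_of_nonneg_left hearly hnk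

/-- **THE GEOMETRY OF THREE OLD LEVELS.**  Ages `1 ≤ j < k < n < K` along a box solution of an isotone dominated memory with floor: with `σ₁ = h_{m+j}∕h_{m+k}`,
`σ₂ = h_{m+k}∕h_{m+n}`: `1 ≤ σ₁`, `1 ≤ σ₂`, `σ₁²·j ≤ k`, `σ₂²·k ≤ n` (rays from the pin, (E102b)) and the chord concavity in ratio form
`(k−j)·σ₁²·(σ₂²−1) ≤ (n−k)·(σ₁²−1)`. [folklore] -/
theorem triple_sigma_bounds (hmono : ∀ u v : ℕ → ℝ, SeqBox γ u → SeqBox γ v → (∀ j, u j ≤ v j) → B u ≤ B v)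
    (hL : ∀ k, 0 ≤ L k) (hb : 0 < b) (hlo : ∀ u, SeqBox γ u → b ≤ B u) (hdom : ∀ u, SeqBox γ u → ∑ k ∈ range K, L k * u k ≤ B u)
    (hh : SeqBox γ h) (hf : MemFlow B gIR h) {j k n : ℕ} (hj : 1 ≤ j) (hjk : j < k) (hkn : k < n) (hnK : n < K) (m : ℕ) :
    1 ≤ h (m + j) / h (m + k) ∧ 1 ≤ h (m + k) / h (m + n) ∧ (h (m + j) / h (m + k)) ^ 2 * j ≤ k ∧ (h (m + k) / h (m + n)) ^ 2 * k ≤ n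
    ∧ ((k : ℝ) - j) * (h (m + j) / h (m + k)) ^ 2 * ((h (m + k) / h (m + n)) ^ 2 - 1) ≤ ((n : ℝ) - k) * ((h (m + j) / h (m + k)) ^ 2 - 1) := by
  have hpos : ∀ n, 0 < h n := fun n => (hh n).1
  obtain ⟨h1, h2, -, -⟩ := old_pair_letters_split hmono hL hb hlo hdom hh hf hj hjk (lt_trans hkn hnK) (T := 0) (by omega) (c := 0) (cT := 0)
    (cb := 0) (by rw [zero_pow two_ne_zero, zero_mul]; positivity) (by rw [zero_pow two_ne_zero, zero_mul]; positivity)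
    (by rw [zero_pow two_ne_zero, zero_mul]; positivity) m
  obtain ⟨h3, h4, -, -⟩ := old_pair_letters_split hmono hL hb hlo hdom hh hf (by omega) hkn hnK (T := 0) (by omega) (c := 0) (cT := 0)
    (cb := 0) (by rw [zero_pow two_ne_zero, zero_mul]; positivity) (by rw [zero_pow two_ne_zero, zero_mul]; positivity)
    (by rw [zero_pow two_ne_zero, zero_mul]; positivity) m
  refine ⟨h1, h3, h2, h4, ?_⟩
  have hc := chord_concavity hmono hb hlo hh hf hjk.le hkn.le m
  have hj' := hpos (m + j); have hk' := hpos (m + k); have hn' := hpos (m + n)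
  -- multiply the chord inequality by h_{m+k}²·(h_{m+j}∕h_{m+k})² … i.e. rewrite the ratios
  have e1 : (h (m + j) / h (m + k)) ^ 2 * ((h (m + k) / h (m + n)) ^ 2 - 1)
      = h (m + j) ^ 2 * (1 / h (m + n) ^ 2 - 1 / h (m + k) ^ 2) := by field_simp
  have e2 : (h (m + j) / h (m + k)) ^ 2 - 1 = h (m + j) ^ 2 * (1 / h (m + k) ^ 2 - 1 / h (m + j) ^ 2) := by field_simp
  rw [mul_assoc, e1, e2]
  have := mul_le_mul_of_nonneg_left hc (sq_nonneg (h (m + j)))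
  nlinarith [this]

/-! ## §2 The three pin windows in load coordinates -/

/-- **THE YOUNGEST WINDOW OF AN OLD TRIPLE (W_j).**  Ages `1 ≤ j < k < n < K` loaded (`L ≥ 0`), constants `c₀²(3j+1) ≤ 2j` (own window), `c₁²(2k+j+1) ≤ 2k`,
`c₂²(2n+j+1) ≤ 2n` (the `j` levels after `m+k`, `m+n` under their rays); `σ₁ = h_{m+j}∕h_{m+k}`, `σ₂ = h_{m+k}∕h_{m+n}`, loads `x, z, y` of `j, k, n`:
`2c₀·x + 2c₁(j∕k)σ₁²·z + 2c₂(j∕n)(σ₁σ₂)²·y ≤ 1` (all reads over `[m, m+j)` are below the rise `1∕h_{m+j}²`, (E100a) `block_window_reads_le`). [folklore] -/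
theorem triple_letter_young (hmono : ∀ u v : ℕ → ℝ, SeqBox γ u → SeqBox γ v → (∀ j, u j ≤ v j) → B u ≤ B v)
    (hL : ∀ k, 0 ≤ L k) (hb : 0 < b) (hlo : ∀ u, SeqBox γ u → b ≤ B u) (hdom : ∀ u, SeqBox γ u → ∑ k ∈ range K, L k * u k ≤ B u)
    (hh : SeqBox γ h) (hf : MemFlow B gIR h) {j k n : ℕ} (hj : 1 ≤ j) (hjk : j < k) (hkn : k < n) (hnK : n < K) {c₀ c₁ c₂ : ℝ}
    (hc₀ : c₀ ^ 2 * (3 * (j : ℝ) + 1) ≤ 2 * j) (hc₁ : c₁ ^ 2 * (2 * (k : ℝ) + j + 1) ≤ 2 * k) (hc₂ : c₂ ^ 2 * (2 * (n : ℝ) + j + 1) ≤ 2 * n) (m : ℕ) :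
    2 * c₀ * ((j : ℝ) * (L j * h (m + j) ^ 3 / 2)) + 2 * c₁ * ((j : ℝ) / k) * (h (m + j) / h (m + k)) ^ 2 * ((k : ℝ) * (L k * h (m + k) ^ 3 / 2))
      + 2 * c₂ * ((j : ℝ) / n) * (h (m + j) / h (m + k) * (h (m + k) / h (m + n))) ^ 2 * ((n : ℝ) * (L n * h (m + n) ^ 3 / 2)) ≤ 1 := by
  have hpos : ∀ n, 0 < h n := fun n => (hh n).1
  have hj' := hpos (m + j); have hk' := hpos (m + k); have hn' := hpos (m + n)
  have hk1 : 1 ≤ k := by omega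
  have hn1 : 1 ≤ n := by omega
  have hreads := block_window_reads_le hL hdom hh hf (S := {j, k, n}) (fun i hi => by
    simp only [mem_insert, mem_singleton] at hi; rcases hi with rfl | rfl | rfl <;> omega) m j
  rw [sum_insert (by simp; omega), sum_pair (by omega)] at hreads
  have Rj : c₀ * j * h (m + j) ≤ ∑ q ∈ range j, h (m + q + 1 + j) :=
    (window_sum_ge hmono hb hlo hh hf hj hc₀ m).trans_eq (sum_congr rfl fun q _ => by rw [show m + j + 1 + q = m + q + 1 + j by ring])
  have Rk : c₁ * j * h (m + k) ≤ ∑ q ∈ range j, h (m + q + 1 + k) := old_reads_ge hmono hb hlo hh hf hk1 j hc₁ m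
  have Rn : c₂ * j * h (m + n) ≤ ∑ q ∈ range j, h (m + q + 1 + n) := old_reads_ge hmono hb hlo hh hf hn1 j hc₂ m
  have hsum : L j * (c₀ * j * h (m + j)) + L k * (c₁ * j * h (m + k)) + L n * (c₂ * j * h (m + n)) ≤ 1 / h (m + j) ^ 2 := by
    have e1 := mul_le_mul_of_nonneg_left Rj (hL j)
    have e2 := mul_le_mul_of_nonneg_left Rk (hL k)
    have e3 := mul_le_mul_of_nonneg_left Rn (hL n)
    linarith
  have key := mul_le_mul_of_nonneg_left hsum (sq_nonneg (h (m + j)))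
  have e1 : h (m + j) ^ 2 * (1 / h (m + j) ^ 2) = 1 := by field_simp
  have e2 : h (m + j) ^ 2 * (L j * (c₀ * j * h (m + j)) + L k * (c₁ * j * h (m + k)) + L n * (c₂ * j * h (m + n)))
      = 2 * c₀ * ((j : ℝ) * (L j * h (m + j) ^ 3 / 2)) + 2 * c₁ * ((j : ℝ) / k) * (h (m + j) / h (m + k)) ^ 2 * ((k : ℝ) * (L k * h (m + k) ^ 3 / 2))
        + 2 * c₂ * ((j : ℝ) / n) * (h (m + j) / h (m + k) * (h (m + k) / h (m + n))) ^ 2 * ((n : ℝ) * (L n * h (m + n) ^ 3 / 2)) := by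
    have hkr : (k : ℝ) ≠ 0 := by exact_mod_cast (show k ≠ 0 by omega)
    have hnr : (n : ℝ) ≠ 0 := by exact_mod_cast (show n ≠ 0 by omega)
    field_simp
  rw [e1, e2] at key
  exact key

/-- **THE MIDDLE WINDOW OF AN OLD TRIPLE (W_k).**  As `triple_letter_young`, window `[m, m+k)`: the younger age `j` by the split stretch (`T₁ + j ≤ k`,
`c_{T₁}²(2j+T₁+1) ≤ 2j`, far constant `c₁²(2k+j+1) ≤ 2k`), the own age by `c₀` (`c₀²(3j+1) ≤ 2j` suffices, (E102b) `own_const_mono`), the older age `n`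
by `c₃²(2n+k+1) ≤ 2n`: `[2c_{T₁}(T₁∕j)∕σ₁² + 2((k−j−T₁)∕j + c₁)∕σ₁³]·x + 2c₀·z + 2c₃(k∕n)σ₂²·y ≤ 1`. [folklore] -/
theorem triple_letter_mid (hmono : ∀ u v : ℕ → ℝ, SeqBox γ u → SeqBox γ v → (∀ j, u j ≤ v j) → B u ≤ B v)
    (hL : ∀ k, 0 ≤ L k) (hb : 0 < b) (hlo : ∀ u, SeqBox γ u → b ≤ B u) (hdom : ∀ u, SeqBox γ u → ∑ k ∈ range K, L k * u k ≤ B u)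
    (hh : SeqBox γ h) (hf : MemFlow B gIR h) {j k n T₁ : ℕ} (hj : 1 ≤ j) (hjk : j < k) (hkn : k < n) (hnK : n < K) (hT₁ : T₁ + j ≤ k)
    {c₀ c₁ c₃ cT₁ : ℝ} (hc₀ : c₀ ^ 2 * (3 * (j : ℝ) + 1) ≤ 2 * j) (hc₁ : c₁ ^ 2 * (2 * (k : ℝ) + j + 1) ≤ 2 * k)
    (hc₃ : c₃ ^ 2 * (2 * (n : ℝ) + k + 1) ≤ 2 * n) (hcT₁ : cT₁ ^ 2 * (2 * (j : ℝ) + T₁ + 1) ≤ 2 * j) (m : ℕ) :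
    (2 * cT₁ * ((T₁ : ℝ) / j) / (h (m + j) / h (m + k)) ^ 2 + 2 * (((k : ℝ) - j - T₁) / j + c₁) / (h (m + j) / h (m + k)) ^ 3)
        * ((j : ℝ) * (L j * h (m + j) ^ 3 / 2))
      + 2 * c₀ * ((k : ℝ) * (L k * h (m + k) ^ 3 / 2)) + 2 * c₃ * ((k : ℝ) / n) * (h (m + k) / h (m + n)) ^ 2 * ((n : ℝ) * (L n * h (m + n) ^ 3 / 2)) ≤ 1 := by
  have hpos : ∀ n, 0 < h n := fun n => (hh n).1
  have hj' := hpos (m + j); have hk' := hpos (m + k); have hn' := hpos (m + n)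
  have hk1 : 1 ≤ k := by omega
  have hn1 : 1 ≤ n := by omega
  have hc₀k : c₀ ^ 2 * (3 * (k : ℝ) + 1) ≤ 2 * k := own_const_mono hj hjk.le hc₀
  have hreads := block_window_reads_le hL hdom hh hf (S := {j, k, n}) (fun i hi => by
    simp only [mem_insert, mem_singleton] at hi; rcases hi with rfl | rfl | rfl <;> omega) m k
  rw [sum_insert (by simp; omega), sum_pair (by omega)] at hreads
  have Rj : cT₁ * T₁ * h (m + j) + (((k : ℝ) - j - T₁) + c₁ * j) * h (m + k) ≤ ∑ q ∈ range k, h (m + q + 1 + j) :=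
    young_reads_ge_split hmono hb hlo hh hf hj hjk hT₁ hcT₁ hc₁ m
  have Rk : c₀ * k * h (m + k) ≤ ∑ q ∈ range k, h (m + q + 1 + k) :=
    (window_sum_ge hmono hb hlo hh hf hk1 hc₀k m).trans_eq (sum_congr rfl fun q _ => by rw [show m + k + 1 + q = m + q + 1 + k by ring])
  have Rn : c₃ * k * h (m + n) ≤ ∑ q ∈ range k, h (m + q + 1 + n) := old_reads_ge hmono hb hlo hh hf hn1 k hc₃ m
  have hsum : L j * (cT₁ * T₁ * h (m + j) + (((k : ℝ) - j - T₁) + c₁ * j) * h (m + k)) + L k * (c₀ * k * h (m + k))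
      + L n * (c₃ * k * h (m + n)) ≤ 1 / h (m + k) ^ 2 := by
    have e1 := mul_le_mul_of_nonneg_left Rj (hL j)
    have e2 := mul_le_mul_of_nonneg_left Rk (hL k)
    have e3 := mul_le_mul_of_nonneg_left Rn (hL n)
    linarith
  have key := mul_le_mul_of_nonneg_left hsum (sq_nonneg (h (m + k)))
  have e1 : h (m + k) ^ 2 * (1 / h (m + k) ^ 2) = 1 := by field_simp
  have e2 : h (m + k) ^ 2 * (L j * (cT₁ * T₁ * h (m + j) + (((k : ℝ) - j - T₁) + c₁ * j) * h (m + k)) + L k * (c₀ * k * h (m + k))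
      + L n * (c₃ * k * h (m + n)))
      = (2 * cT₁ * ((T₁ : ℝ) / j) / (h (m + j) / h (m + k)) ^ 2 + 2 * (((k : ℝ) - j - T₁) / j + c₁) / (h (m + j) / h (m + k)) ^ 3)
          * ((j : ℝ) * (L j * h (m + j) ^ 3 / 2))
        + 2 * c₀ * ((k : ℝ) * (L k * h (m + k) ^ 3 / 2))
        + 2 * c₃ * ((k : ℝ) / n) * (h (m + k) / h (m + n)) ^ 2 * ((n : ℝ) * (L n * h (m + n) ^ 3 / 2)) := by
    have hjr : (j : ℝ) ≠ 0 := by exact_mod_cast (show j ≠ 0 by omega)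
    have hnr : (n : ℝ) ≠ 0 := by exact_mod_cast (show n ≠ 0 by omega)
    field_simp
  rw [e1, e2] at key
  exact key

/-- **THE OLDEST WINDOW OF AN OLD TRIPLE (W_n).**  Window `[m, m+n)`: both younger ages by their split stretches (`T₂ + j ≤ n`, `c_{T₂}²(2j+T₂+1) ≤ 2j`, far
constant `c₂²(2n+j+1) ≤ 2n`; `T₃ + k ≤ n`, `c_{T₃}²(2k+T₃+1) ≤ 2k`, far constant `c₃²(2n+k+1) ≤ 2n`), the own age by `c₀`:
`[2c_{T₂}(T₂∕j)∕(σ₁σ₂)² + 2((n−j−T₂)∕j + c₂)∕(σ₁σ₂)³]·x + [2c_{T₃}(T₃∕k)∕σ₂² + 2((n−k−T₃)∕k + c₃)∕σ₂³]·z + 2c₀·y ≤ 1`. [folklore] -/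
theorem triple_letter_old (hmono : ∀ u v : ℕ → ℝ, SeqBox γ u → SeqBox γ v → (∀ j, u j ≤ v j) → B u ≤ B v)
    (hL : ∀ k, 0 ≤ L k) (hb : 0 < b) (hlo : ∀ u, SeqBox γ u → b ≤ B u) (hdom : ∀ u, SeqBox γ u → ∑ k ∈ range K, L k * u k ≤ B u)
    (hh : SeqBox γ h) (hf : MemFlow B gIR h) {j k n T₂ T₃ : ℕ} (hj : 1 ≤ j) (hjk : j < k) (hkn : k < n) (hnK : n < K) (hT₂ : T₂ + j ≤ n)
    (hT₃ : T₃ + k ≤ n) {c₀ c₂ c₃ cT₂ cT₃ : ℝ} (hc₀ : c₀ ^ 2 * (3 * (j : ℝ) + 1) ≤ 2 * j) (hc₂ : c₂ ^ 2 * (2 * (n : ℝ) + j + 1) ≤ 2 * n)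
    (hc₃ : c₃ ^ 2 * (2 * (n : ℝ) + k + 1) ≤ 2 * n) (hcT₂ : cT₂ ^ 2 * (2 * (j : ℝ) + T₂ + 1) ≤ 2 * j)
    (hcT₃ : cT₃ ^ 2 * (2 * (k : ℝ) + T₃ + 1) ≤ 2 * k) (m : ℕ) :
    (2 * cT₂ * ((T₂ : ℝ) / j) / (h (m + j) / h (m + k) * (h (m + k) / h (m + n))) ^ 2
          + 2 * (((n : ℝ) - j - T₂) / j + c₂) / (h (m + j) / h (m + k) * (h (m + k) / h (m + n))) ^ 3) * ((j : ℝ) * (L j * h (m + j) ^ 3 / 2))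
      + (2 * cT₃ * ((T₃ : ℝ) / k) / (h (m + k) / h (m + n)) ^ 2 + 2 * (((n : ℝ) - k - T₃) / k + c₃) / (h (m + k) / h (m + n)) ^ 3)
          * ((k : ℝ) * (L k * h (m + k) ^ 3 / 2))
      + 2 * c₀ * ((n : ℝ) * (L n * h (m + n) ^ 3 / 2)) ≤ 1 := by
  have hpos : ∀ n, 0 < h n := fun n => (hh n).1
  have hj' := hpos (m + j); have hk' := hpos (m + k); have hn' := hpos (m + n)
  have hk1 : 1 ≤ k := by omega
  have hn1 : 1 ≤ n := by omega
  have hc₀n : c₀ ^ 2 * (3 * (n : ℝ) + 1) ≤ 2 * n := own_const_mono hj (by omega) hc₀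
  have hreads := block_window_reads_le hL hdom hh hf (S := {j, k, n}) (fun i hi => by
    simp only [mem_insert, mem_singleton] at hi; rcases hi with rfl | rfl | rfl <;> omega) m n
  rw [sum_insert (by simp; omega), sum_pair (by omega)] at hreads
  have Rj : cT₂ * T₂ * h (m + j) + (((n : ℝ) - j - T₂) + c₂ * j) * h (m + n) ≤ ∑ q ∈ range n, h (m + q + 1 + j) :=
    young_reads_ge_split hmono hb hlo hh hf hj (lt_trans hjk hkn) hT₂ hcT₂ hc₂ m
  have Rk : cT₃ * T₃ * h (m + k) + (((n : ℝ) - k - T₃) + c₃ * k) * h (m + n) ≤ ∑ q ∈ range n, h (m + q + 1 + k) :=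
    young_reads_ge_split hmono hb hlo hh hf hk1 hkn hT₃ hcT₃ hc₃ m
  have Rn : c₀ * n * h (m + n) ≤ ∑ q ∈ range n, h (m + q + 1 + n) :=
    (window_sum_ge hmono hb hlo hh hf hn1 hc₀n m).trans_eq (sum_congr rfl fun q _ => by rw [show m + n + 1 + q = m + q + 1 + n by ring])
  have hsum : L j * (cT₂ * T₂ * h (m + j) + (((n : ℝ) - j - T₂) + c₂ * j) * h (m + n))
      + L k * (cT₃ * T₃ * h (m + k) + (((n : ℝ) - k - T₃) + c₃ * k) * h (m + n)) + L n * (c₀ * n * h (m + n)) ≤ 1 / h (m + n) ^ 2 := by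
    have e1 := mul_le_mul_of_nonneg_left Rj (hL j)
    have e2 := mul_le_mul_of_nonneg_left Rk (hL k)
    have e3 := mul_le_mul_of_nonneg_left Rn (hL n)
    linarith
  have key := mul_le_mul_of_nonneg_left hsum (sq_nonneg (h (m + n)))
  have e1 : h (m + n) ^ 2 * (1 / h (m + n) ^ 2) = 1 := by field_simp
  have e2 : h (m + n) ^ 2 * (L j * (cT₂ * T₂ * h (m + j) + (((n : ℝ) - j - T₂) + c₂ * j) * h (m + n))
      + L k * (cT₃ * T₃ * h (m + k) + (((n : ℝ) - k - T₃) + c₃ * k) * h (m + n)) + L n * (c₀ * n * h (m + n)))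
      = (2 * cT₂ * ((T₂ : ℝ) / j) / (h (m + j) / h (m + k) * (h (m + k) / h (m + n))) ^ 2
            + 2 * (((n : ℝ) - j - T₂) / j + c₂) / (h (m + j) / h (m + k) * (h (m + k) / h (m + n))) ^ 3) * ((j : ℝ) * (L j * h (m + j) ^ 3 / 2))
        + (2 * cT₃ * ((T₃ : ℝ) / k) / (h (m + k) / h (m + n)) ^ 2 + 2 * (((n : ℝ) - k - T₃) / k + c₃) / (h (m + k) / h (m + n)) ^ 3)
            * ((k : ℝ) * (L k * h (m + k) ^ 3 / 2))
        + 2 * c₀ * ((n : ℝ) * (L n * h (m + n) ^ 3 / 2)) := by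
    have hjr : (j : ℝ) ≠ 0 := by exact_mod_cast (show j ≠ 0 by omega)
    have hkr : (k : ℝ) ≠ 0 := by exact_mod_cast (show k ≠ 0 by omega)
    field_simp
  rw [e1, e2] at key
  exact key

end Summit.QuantumFields.BalabanUV.Beta.EriceRemainderEnclosureHistoryAutonomyComparisonAgeCompositionOldTripleLetters
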